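import Summits.QuantumFields.BalabanUV.T4Continuum.Support.NE9EvalChannelCouplingModulus

/-!
# NE9EvalChannelPieceResponse — the CHANNEL COUPLING MODULUS `hTcup` (leaf A3) of an EVALUATION–INTEGRAL channel from a
PER-PIECE RESPONSE bound and its E₀-free mass (the shape of [II] (1.24) × (1.25)–(1.29)), with the located FINDING
F-ne9leaf03g3-1 on the sibling `NE9EvalChannelCouplingModulus` §2 as an instantiation route (cell `pub-balaban`, T4-DAG §2 node
U3 ∕ §6 NE9; NE9 formalisation swarm, unit `b2b-balaban-t4-ne9-formalise-leaf-03` gen 3; GAPS.md F-ne9leaf03g3-1)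

HONEST FRAMING (T4-DAG PAGE 1).  Rung (B)+1 on a FIXED finite torus — NOT infinite volume, NOT a mass gap, NOT the Clay
problem.  NE9 is a cell NEW ESTIMATE, NOT PRINTED, NOT discharged here.  Bookkeeping over the ABSTRACT carriers of
`T4OutputRate` and the co-owner's `NE9EvaluationChannel.evalChannel`; every analytic input is a DISPLAYED binder stated INLINE
(no Prop-valued definition; trigger c3).  [I] = [Balaban1987RG1], [II] = [Balaban1988RG2Cluster] quoted for TYPES only
(ABSOLUTE RULE).  `FlowStep.BetaPertH`, (B), (B^μ) do not occur.

WHY A SIBLING.  The sibling `NE9EvalChannelCouplingModulus` (p210130) derives `hTcup` from a UNIFORM background modulus of the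
read family × ONE shift bound × the kernel's decay-weighted SHIFT MASS (§1 there), specialised in its §2 to node U3's
`T4OutputRate.LipBackground` with a k-uniform constant.  FINDING F-ne9leaf03g3-1 (located, [II] p. 8 l. 1–10; census-class, no
kernel statement affected): on Bałaban's (1.23) kernel that route is NOT k-uniformly instantiable — the per-creation-step count
(6L)⁴(L^jη)^{−4} of source cubes is beaten only by the factor (L^jη)⁵ of the PER-PIECE bound (1.24) ((I.3.54), marginal-free
package — the mechanism of the owner's O-ne9p1g22-1 for leaf S5), which a Lipschitz constant in the carrier's sup-gauge does
not carry.  THIS FILE states the family-side input PER PIECE (§1) — the shape in which (1.24) is printed and in which the owner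
lineage's `NE9Lemma1Gather`∕`NE9Lemma1Counting` type the E₀-free counting — and shows the sibling's §1 is its special case (§2).
Same content is filed as the sibling's append-only v1.1 §5 (p210667, existing-target lane); whichever the gate applies first is
the tree's copy, the other bounces on the dedup lint by design.

WHAT IS PROVED (kernel, `[folklore]`; 0 sorry, 0 `def`).
§1 **`channelCouplingModulus_eval_of_pieceResponse`** (`hTcup` LITERALLY, `qT` displayed).
§2 `example`: the sibling's §1 conclusion RE-DERIVED from §1 at `pc := CUbar·e^{−κd}·amp` (dictionary between the two
   shapes; an `example` because its statement is the landed one).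

References (TYPES only): [Balaban1988RG2Cluster] CMP 116 (1988) (1.21)–(1.24) p. 7, (1.25)–(1.29) and l. 1–10 p. 8, (1.33)–(1.36)
p. 9; [Balaban1987RG1] CMP 109 (1987) (2.12)–(2.13) p. 268.
-/

noncomputable section

namespace Summit.QuantumFields.BalabanUV.T4Continuum.NE9EvalChannelPieceResponse

open scoped BigOperators
open MeasureTheory
open Literature.MathematicalPhysics.QuantumFieldTheory.Balaban1983to89
open Literature.MathematicalPhysics.QuantumFieldTheory.Balaban1983to89.T4OutputRate
open Summit.QuantumFields.BalabanUV.T4Continuum.NE9EvaluationChannel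
open Summit.QuantumFields.BalabanUV.T4Continuum.NE9EvalChannelCouplingModulus

variable {C : Carriers} {Bg ι : Type} {Ω : Type*} [MeasurableSpace Ω]

/-! ## §1 `hTcup` from a PER-PIECE RESPONSE bound — the shape of print's (1.24), where the per-creation-step gain lives -/

/-- **`hTcup` FROM A PER-PIECE RESPONSE BOUND AND ITS MASS (kernel) — with the located FINDING F-ne9leaf03g3-1 on §2 as
an INSTANTIATION ROUTE.**  FINDING (located; a census-class remark on this file's own §2, not an objection to any statement):
§2 derives `hTcup` from a k-UNIFORM background-Lipschitz constant of the terms (`LipBackground`, generic Cauchy constant of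
[III] (2.27)(ii)) times the kernel's decay-weighted SHIFT MASS with a k-UNIFORM `qA`.  On Bałaban's (1.23) kernel with
`amp` = the sup-size of the shift this last binder is NOT available uniformly in k: the source domains of creation step `j`
inside the scale-k cube are counted on p. 8 of [II] — «At first we consider the sum over X. We take X∈𝐃_j, X ⊂ □̃². This sum can
be bounded by two sums, the first is over □′∈π_j, □′ ⊂ □̃², the second over X∈𝐃_j such that □′ ⊂ X» … «To bound the first sum,
over □′ ⊂ □̃², we use the factor (L^jη)⁵ in (1.24). This yields (6L)⁴L^jη, and the sum over j is bounded by 2(6L)⁴.» — i.e. the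
first sum has (6L)⁴(L^jη)^{−4} members, and ONLY the factor (L^jη)⁵ of the per-piece bound (1.24) (from (I.3.54): the response of
the MARGINAL-FREE step-j package to a scale-k perturbation — the mechanism of the owner's located correction O-ne9p1g22-1 for
leaf S5) makes the j-sum converge.  A generic Lipschitz constant in the carrier's sup-gauge carries no such factor, so §2 ∘ (k-uniform
`qA`) is a socket for channels with O(1) decay-weighted shift mass per step (P2's witness-type kernels, the toy of §4), NOT the
route to the instance O-NE9-5.  REPAIR SHAPE (this theorem): the family-side input is stated PER PIECE — for every source domain
`X` of the step-k∕index-y family and every parameter `ω`, the evaluated family responds to the change of the k-th coupling by at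
most `pc k g y X ω·|g k − g′ k|` (DISPLAYED; printed TYPE = (1.24) read for the g_k-dependence through 𝐇_k, with its factors
«g_k|B|», «E₀(α₁∕α₃)⁵(L^jη)⁵», «exp(−κd_j(X))» all inside `pc`; PROOF-INTERIOR (I.3.54), asserted nowhere here) — and the kernel
input is the E₀-free MASS `Σ_X ∫ |w₀ k y X ω|·pc k g y X ω ∂ν₀ ≤ wt k y·qT k` (TYPE (1.25)–(1.29) p. 7–8 = the counting the
owner's `NE9Lemma1Counting` item types at one creation step).  The sibling's §1 `channelCouplingModulus_eval` is the special case `pc k g y X ω := CUbar·e^{−κd(X)}·amp k y X ω` (§2 below,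
kernel).  Conclusion: LITERALLY the END's `hTcup` clause.
[cite: Balaban1988RG2Cluster, (1.23)-(1.24) p.7, (1.25)-(1.29) pp.7-8, p.8 l.1-10; Balaban1987RG1, (2.12)-(2.13) p.268] -/
theorem channelCouplingModulus_eval_of_pieceResponse {W : Set (ℕ → ℝ)} {H : (ℕ → ℝ) → Bg → C.Dom → ℝ}
    {F₀ : ℕ → ι → Finset C.Dom} {ν₀ : ℕ → ι → C.Dom → Measure Ω} {w₀ : ℕ → ι → C.Dom → Ω → ℝ}
    {bg : ℕ → (ℕ → ℝ) → ι → C.Dom → Ω → Bg} {pc : ℕ → (ℕ → ℝ) → ι → C.Dom → Ω → ℝ} {wt : ℕ → ι → ℝ} {qT : ℕ → ℝ}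
    (hH : ∀ g ∈ W, H g ∈ EvalAdm (fun k _ y => F₀ k y) (fun k _ y => ν₀ k y) (fun k _ y => w₀ k y) bg)
    (hwp : ∀ g ∈ W, ∀ (k : ℕ) (y : ι), ∀ X ∈ F₀ k y, Integrable (fun ω => |w₀ k y X ω| * pc k g y X ω) (ν₀ k y X))
    (hpiece : ∀ g ∈ W, ∀ g' ∈ W, ∀ (k : ℕ) (y : ι), ∀ X ∈ F₀ k y, ∀ ω,
      |H g (bg k g y X ω) X - H g (bg k g' y X ω) X| ≤ pc k g y X ω * |g k - g' k|)
    (hmass : ∀ g ∈ W, ∀ (k : ℕ) (y : ι),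
      ∑ X ∈ F₀ k y, ∫ ω, |w₀ k y X ω| * pc k g y X ω ∂(ν₀ k y X) ≤ wt k y * qT k) :
    ∀ g ∈ W, ∀ g' ∈ W, ∀ (k : ℕ) (y : ι),
      |evalChannel (fun k _ y => F₀ k y) (fun k _ y => ν₀ k y) (fun k _ y => w₀ k y) bg k g (H g) y -
          evalChannel (fun k _ y => F₀ k y) (fun k _ y => ν₀ k y) (fun k _ y => w₀ k y) bg k g' (H g) y| ≤
        wt k y * (qT k * |g k - g' k|) := by
  intro g hg g' hg' k y
  simp only [evalChannel]
  rw [← Finset.sum_sub_distrib]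
  have hΔ : 0 ≤ |g k - g' k| := abs_nonneg _
  calc |∑ X ∈ F₀ k y, ((∫ ω, w₀ k y X ω * H g (bg k g y X ω) X ∂(ν₀ k y X)) -
            ∫ ω, w₀ k y X ω * H g (bg k g' y X ω) X ∂(ν₀ k y X))|
      ≤ ∑ X ∈ F₀ k y, |(∫ ω, w₀ k y X ω * H g (bg k g y X ω) X ∂(ν₀ k y X)) -
            ∫ ω, w₀ k y X ω * H g (bg k g' y X ω) X ∂(ν₀ k y X)| := Finset.abs_sum_le_sum_abs _ _
    _ ≤ ∑ X ∈ F₀ k y, (∫ ω, |w₀ k y X ω| * pc k g y X ω ∂(ν₀ k y X)) * |g k - g' k| := by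
        refine Finset.sum_le_sum fun X hX => ?_
        exact abs_integral_mul_sub_le_of_shift ((hH g hg) k g y X hX) ((hH g hg) k g' y X hX) (hwp g hg k y X hX)
          fun ω => by rw [mul_comm]; exact hpiece g hg g' hg' k y X hX ω
    _ = (∑ X ∈ F₀ k y, ∫ ω, |w₀ k y X ω| * pc k g y X ω ∂(ν₀ k y X)) * |g k - g' k| := by
        rw [Finset.sum_mul]
    _ ≤ wt k y * qT k * |g k - g' k| := mul_le_mul_of_nonneg_right (hmass g hg k y) hΔ
    _ = wt k y * (qT k * |g k - g' k|) := by ring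

/-! ## §2 The sibling's uniform-modulus route is the special case `pc := CUbar·e^{−κd}·amp` -/

/-- The sibling's `channelCouplingModulus_eval` (uniform background modulus `CUbar` × shift bound × decay-weighted shift mass)
RE-DERIVED from §1 at `pc k g y X ω := CUbar·e^{−κd(X)}·amp k y X ω` — kernel check of the dictionary between the two shapes;
statement copied token for token from the sibling's §1 (an `example`, since the statement IS the landed one — dedup lint).
[folklore] -/
example {W : Set (ℕ → ℝ)} {H : (ℕ → ℝ) → Bg → C.Dom → ℝ}
    {F₀ : ℕ → ι → Finset C.Dom} {ν₀ : ℕ → ι → C.Dom → Measure Ω} {w₀ : ℕ → ι → C.Dom → Ω → ℝ}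
    {bg : ℕ → (ℕ → ℝ) → ι → C.Dom → Ω → Bg} (gauge : Bg → Bg → ℝ) {amp : ℕ → ι → C.Dom → Ω → ℝ}
    {κ CUbar : ℝ} {wt : ℕ → ι → ℝ} {qA : ℕ → ℝ}
    (hH : ∀ g ∈ W, H g ∈ EvalAdm (fun k _ y => F₀ k y) (fun k _ y => ν₀ k y) (fun k _ y => w₀ k y) bg)
    (hCU0 : 0 ≤ CUbar)
    (hLip : ∀ g ∈ W, ∀ (U U' : Bg) (X : C.Dom),
      |H g U X - H g U' X| ≤ CUbar * Real.exp (-(κ * C.d X)) * gauge U U')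
    (hwa : ∀ (k : ℕ) (y : ι), ∀ X ∈ F₀ k y, Integrable (fun ω => |w₀ k y X ω| * amp k y X ω) (ν₀ k y X))
    (hshift : ∀ g ∈ W, ∀ g' ∈ W, ∀ (k : ℕ) (y : ι), ∀ X ∈ F₀ k y, ∀ ω,
      gauge (bg k g y X ω) (bg k g' y X ω) ≤ amp k y X ω * |g k - g' k|)
    (hmass : ∀ (k : ℕ) (y : ι),
      ∑ X ∈ F₀ k y, Real.exp (-(κ * C.d X)) * ∫ ω, |w₀ k y X ω| * amp k y X ω ∂(ν₀ k y X) ≤ wt k y * qA k) :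
    ∀ g ∈ W, ∀ g' ∈ W, ∀ (k : ℕ) (y : ι),
      |evalChannel (fun k _ y => F₀ k y) (fun k _ y => ν₀ k y) (fun k _ y => w₀ k y) bg k g (H g) y -
          evalChannel (fun k _ y => F₀ k y) (fun k _ y => ν₀ k y) (fun k _ y => w₀ k y) bg k g' (H g) y| ≤
        wt k y * (CUbar * qA k * |g k - g' k|) := by
  have h := channelCouplingModulus_eval_of_pieceResponse (H := H) (bg := bg)
    (pc := fun k _ y X ω => CUbar * Real.exp (-(κ * C.d X)) * amp k y X ω) (wt := wt) (qT := fun k => CUbar * qA k) hH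
    (fun g _ k y X hX => by
      simpa [mul_comm, mul_left_comm, mul_assoc] using ((hwa k y X hX).const_mul (CUbar * Real.exp (-(κ * C.d X)))))
    (fun g hg g' hg' k y X hX ω => by
      have he : 0 ≤ CUbar * Real.exp (-(κ * C.d X)) := mul_nonneg hCU0 (Real.exp_pos _).le
      calc |H g (bg k g y X ω) X - H g (bg k g' y X ω) X|
          ≤ CUbar * Real.exp (-(κ * C.d X)) * gauge (bg k g y X ω) (bg k g' y X ω) := hLip g hg _ _ X
        _ ≤ CUbar * Real.exp (-(κ * C.d X)) * (amp k y X ω * |g k - g' k|) :=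
            mul_le_mul_of_nonneg_left (hshift g hg g' hg' k y X hX ω) he
        _ = CUbar * Real.exp (-(κ * C.d X)) * amp k y X ω * |g k - g' k| := by ring)
    (fun g _ k y => by
      have hx : ∀ X ∈ F₀ k y, ∫ ω, |w₀ k y X ω| * (CUbar * Real.exp (-(κ * C.d X)) * amp k y X ω) ∂(ν₀ k y X) =
          CUbar * (Real.exp (-(κ * C.d X)) * ∫ ω, |w₀ k y X ω| * amp k y X ω ∂(ν₀ k y X)) := by
        intro X _
        rw [← integral_const_mul, ← integral_const_mul]
        refine integral_congr_ae (Filter.Eventually.of_forall fun ω => ?_)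
        simp only
        ring
      rw [Finset.sum_congr rfl hx, ← Finset.mul_sum]
      calc CUbar * ∑ X ∈ F₀ k y, Real.exp (-(κ * C.d X)) * ∫ ω, |w₀ k y X ω| * amp k y X ω ∂(ν₀ k y X)
          ≤ CUbar * (wt k y * qA k) := mul_le_mul_of_nonneg_left (hmass k y) hCU0
        _ = wt k y * (CUbar * qA k) := by ring)
  intro g hg g' hg' k y
  simpa [mul_assoc] using h g hg g' hg' k y

end Summit.QuantumFields.BalabanUV.T4Continuum.NE9EvalChannelPieceResponse

end
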